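import Summits.CriticalPhenomena.PercolationContinuityZ3.Theorems.PercNearOneGluingNoHeavyQuantTreeBuiltRows
import Summits.CriticalPhenomena.PercolationContinuityZ3.Theorems.PercNearOneGluingNoHeavyQuantDECAtTMixtures
import Summits.CriticalPhenomena.PercolationContinuityZ3.Theorems.PercNearOneGluingNoHeavyQuantGatedConvSplit
import HarnessLib

/-!
# QUANT lane R8, the HULL PROGRAMME at every floor: heavy-top laws, their iterated convolutions, the two typed conjectures
# `LawDec.GatedProductHull` / `LawDec.HeavyTopProductSDEC`, and the KERNEL reduction `Quant.FarTreeRow ⟸ both`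

builds on p205010 (kernel theorem, internal audit signed; external expert review pending)

Support file (`--supports stmt-CriticalPhenomena-4575`), QUANT lane typer seat prim-quant-stmt (gen 35); `run/shared/lean/prim/quant/STATEMENTS.md`
§AP–§AQ.  Definitions + theorems, no sorries, standard axioms.  THE TWO-CONJECTURE ARCHITECTURE OF THE TREE ROW (no floor split):

* `LawDec.HeavyTopLaw y M ν` — a probability law on `{0..M}` whose top atom carries mass `≥ y` (the count law of a caterpillar all of whose
  relay marginals are `≥ y`); `LawDec.HTProd y N P` — `P` on `{0..N}` is an ITERATED CONVOLUTION of heavy-top laws at floor `y`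
  (inductive: one heavy-top law, or such a product convolved with one more heavy-top law).
* **`LawDec.GatedProductHull`** (`@[conjecture]`): every tree-built count law (`LawDec.TreeBuilt x M μ`, any floor `0 < x < 1`) is a finite
  convex combination of GATED HEAVY-TOP PRODUCTS OF ITS OWN MEAN: laws `gate P s` with `x < s ≤ 1`, `HTProd (x/s) N P`, `N ≤ M`,
  `s · mean P = mean μ`.  EVIDENCE (typer g35, exact-pricing column generation, kit jobs attached to the crux item): at floors `≤ 1/2` already
  the PAIRS suffice (`GatedPairHull`, ≈ 1 900 forest and product laws, 0 genuine failures); above `1/2` pairs do NOT suffice (Bin(3,.55) at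
  floor .55: the functional `𝟙{N=1} + ⅓·𝟙{N=3}` separates it from every gated heavy-top pair of mean 1.65) but products do on every tested
  heavy forest at floors .55/.6/.7 (kit j229955: 108/108 certified inside; floor .85: 29/36, the rest undecided by the heuristic pricing).
* **`LawDec.HeavyTopProductSDEC`** (`@[conjecture]`): an iterated convolution of heavy-top laws at floor `0 < y < 1` is top-affordable and SDEC
  at `y`.  PROVED for one factor (`sdec_of_top_ge`, `…QuantHeavyTopSDEC`) and for two (`sdec_lconv_of_top_ge`, `…QuantHeavyTopPairSDEC`);
  a special case of census-2 g53's `SDECConvClosed`.  EVIDENCE: kit j229907 — 872 products of 2–5 random heavy-top laws at floors .25–.9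
  satisfy every TLB/TLC/TLC2 row at 37 gates (0 violations).
* **THE REDUCTION (kernel, this file):** `sdec_of_gatedSDECMixture` — a finite mixture of laws `gate Pᵢ sᵢ` of a COMMON mean, each `Pᵢ`
  top-affordable and SDEC at floor `x/sᵢ`, is SDEC at floor `x` (gate-stability `gate_gate`, Theorem A `decAt_of_top_le` above the
  component's top, `decAtT_mono_top`, convexity `decAtT_finite_mixture`); hence
  **`Quant.farTreeRow_of_gatedProductHull : GatedProductHull → HeavyTopProductSDEC → Quant.FarTreeRow`** (via `tail_ge_of_decAt` and the
  bridge `farTreeRow_of_treeBuilt_rows`) — the R8 tree row at EVERY floor from the two conjectures, with no heavy/light split.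

HONEST STATUS: `GatedProductHull`, `HeavyTopProductSDEC`, `GatedPairHull`, `SDECConvClosed`, `FarTreeRow` are OPEN; this file proves only
the reduction.  Nothing here is a published result. [this work]; product measure [cite: Grimmett1999, §1.3 p. 10]; the gluing rows served
[cite: KozmaNitzan2024, Conjecture 3 (p. 15)].
-/

noncomputable section

namespace Summit.CriticalPhenomena.PercolationContinuityZ3.Theorems

namespace Quant

open Finset

namespace LawDec

/-! ### Heavy-top laws and their iterated convolutions -/

/-- **heavy-top probability law at floor `y` on `{0..M}`**: nonnegative, vanishing above `M`, mass `1`, top-atom mass `ν M ≥ y`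
(the count law of a caterpillar all of whose relay marginals are `≥ y`). [this work] -/
def HeavyTopLaw (y : ℝ) (M : ℕ) (ν : ℕ → ℝ) : Prop :=
  (∀ h, 0 ≤ ν h) ∧ (∀ h, M < h → ν h = 0) ∧ (∑ h ∈ Finset.range (M + 1), ν h = 1) ∧ y ≤ ν M

/-- **iterated convolutions of heavy-top laws at floor `y`** (`HTProd y N P`: `P` on `{0..N}` is `A₁ ∗ ⋯ ∗ A_k` for heavy-top laws `Aᵢ` at
floor `y` on `{0..Nᵢ}`, `N = Σ Nᵢ`, `k ≥ 1`). [this work] -/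
inductive HTProd : ℝ → ℕ → (ℕ → ℝ) → Prop
  | one {y : ℝ} {M : ℕ} {A : ℕ → ℝ} (hA : HeavyTopLaw y M A) : HTProd y M A
  | mul {y : ℝ} {N M : ℕ} {P A : ℕ → ℝ} (hP : HTProd y N P) (hA : HeavyTopLaw y M A) : HTProd y (N + M) (lconv N M P A)

/-- an iterated convolution of heavy-top laws is a probability law on `{0..N}`. [this work] -/
theorem HTProd.lawFacts {y : ℝ} {N : ℕ} {P : ℕ → ℝ} (h : HTProd y N P) :
    (∀ k, 0 ≤ P k) ∧ (∀ k, N < k → P k = 0) ∧ (∑ k ∈ Finset.range (N + 1), P k = 1) := by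
  induction h with
  | one hA => exact ⟨hA.1, hA.2.1, hA.2.2.1⟩
  | mul hP hA ih =>
    exact ⟨lconv_nonneg _ _ _ _ ih.1 hA.1, fun k hk => lconv_eq_zero _ _ _ _ k hk, sum_lconv _ _ _ _ ih.2.2 hA.2.2.1⟩

/-! ### The two conjectures -/

/-- **CONJECTURE (GATED PRODUCT HULL; typer g35).**  Every tree-built count law `μ` on `{0..M}` at a floor `x` (`LawDec.TreeBuilt x M μ`)
is a finite convex combination of gated iterated convolutions of heavy-top laws OF ITS OWN MEAN: laws `gate P s` with `x < s ≤ 1`,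
`HTProd (x/s) N P`, `N ≤ M`, `s · mean P = mean μ`.  At floors `< 1/2` two factors suffice numerically (`GatedPairHull`); above `1/2`
they do not (module docstring).  builds on p205010 (kernel theorem, internal audit signed; external expert review pending).
[this work] [status: open] -/
@[conjecture] def GatedProductHull : Prop :=
  ∀ (x : ℝ) (M : ℕ) (μ : ℕ → ℝ), TreeBuilt x M μ →
    ∃ (ι : Type) (_ : Fintype ι) (w s : ι → ℝ) (N : ι → ℕ) (P : ι → ℕ → ℝ),
      (∀ i, 0 ≤ w i) ∧ (∑ i, w i = 1) ∧ (∀ i, x < s i ∧ s i ≤ 1) ∧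
      (∀ i, HTProd (x / s i) (N i) (P i)) ∧ (∀ i, N i ≤ M) ∧
      (∀ i, s i * (∑ h ∈ Finset.range (N i + 1), (h : ℝ) * P i h) = ∑ h ∈ Finset.range (M + 1), (h : ℝ) * μ h) ∧
      (∀ h, μ h = ∑ i, w i * gate (P i) (s i) h)

/-- **CONJECTURE (ITERATED CONVOLUTIONS OF HEAVY-TOP LAWS ARE SDEC; typer g35).**  For `0 < y < 1`, an iterated convolution `P` on `{0..N}` of
heavy-top laws at floor `y` is top-affordable (`y·N ≤ mean P`) and gate-stable DEC (`SDEC y N P`).  One factor: `sdec_of_top_ge`; two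
factors: `sdec_lconv_of_top_ge`; in general a special case of `SDECConvClosed`.  builds on p205010 (kernel theorem, internal audit signed;
external expert review pending). [this work] [status: open] -/
@[conjecture] def HeavyTopProductSDEC : Prop :=
  ∀ (y : ℝ) (N : ℕ) (P : ℕ → ℝ), 0 < y → y < 1 → HTProd y N P →
    y * (N : ℝ) ≤ (∑ h ∈ Finset.range (N + 1), (h : ℝ) * P h) ∧ SDEC y N P

/-! ### The reduction: mixtures of gated SDEC laws of a common mean -/

/-- **one gated component**: if `P` on `{0..N}` (`N ≤ M`) is a probability law, top-affordable and SDEC at floor `x/s` (`0 < x < s ≤ 1`),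
then for every gate `0 < q ≤ 1` and EVERY layer `j′`, `gate (gate P s) q` is DEC(j′) at floor `q·x` and target `q·s·mean P`, as a law on
`{0..M}` (below the top: SDEC at the gate `q·s`; at or above it: Theorem A; then raise the top). [this work] -/
theorem decAtT_gate_of_gatedSDEC (x s : ℝ) (N M : ℕ) (P : ℕ → ℝ) (hx0 : 0 < x) (hxs : x < s) (hs1 : s ≤ 1)
    (hP0 : ∀ h, 0 ≤ P h) (hPN : ∀ h, N < h → P h = 0) (hP1 : ∑ h ∈ Finset.range (N + 1), P h = 1)
    (hta : x / s * (N : ℝ) ≤ ∑ h ∈ Finset.range (N + 1), (h : ℝ) * P h) (hsd : SDEC (x / s) N P) (hNM : N ≤ M)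
    (q : ℝ) (hq0 : 0 < q) (hq1 : q ≤ 1) (j' : ℕ) :
    DECAtT (q * x) (q * (s * ∑ h ∈ Finset.range (N + 1), (h : ℝ) * P h)) j' M (gate (gate P s) q) := by
  have hs0 : 0 < s := hx0.trans hxs
  have hta' : x * (N : ℝ) ≤ s * ∑ h ∈ Finset.range (N + 1), (h : ℝ) * P h := by
    have := mul_le_mul_of_nonneg_left hta hs0.le
    rw [← mul_assoc, mul_div_cancel₀ _ (ne_of_gt hs0)] at this
    exact this
  rw [gate_gate]
  have hqs0 : 0 < q * s := mul_pos hq0 hs0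
  have hqs1 : q * s ≤ 1 := by nlinarith
  obtain ⟨g0, gM, g1⟩ := gate_laws N P (q * s) hqs0.le hqs1 hP0 hPN hP1
  have gmean : ∑ h ∈ Finset.range (N + 1), (h : ℝ) * gate P (q * s) h = q * (s * ∑ h ∈ Finset.range (N + 1), (h : ℝ) * P h) := by
    rw [sum_mul_gate]; ring
  have hfloor : q * s * (x / s) = q * x := by field_simp
  have hdec : DECAt (q * x) j' N (gate P (q * s)) := by
    by_cases hj : j' < N
    · have := hsd (q * s) hqs0 hqs1 j' hj
      rwa [hfloor] at this
    · refine decAt_of_top_le N _ g0 gM g1 (q * x) (by nlinarith) (fun h hh => ?_) j' (not_lt.1 hj)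
      have hhN : h ≤ N := by
        by_contra hc; exact absurd (gM h (not_le.1 hc)) (ne_of_gt hh)
      rw [gmean]
      have h1 : q * x * (h : ℝ) ≤ q * x * (N : ℝ) := mul_le_mul_of_nonneg_left (by exact_mod_cast hhN) (mul_pos hq0 hx0).le
      have h2 : q * (x * (N : ℝ)) ≤ q * (s * ∑ h ∈ Finset.range (N + 1), (h : ℝ) * P h) := mul_le_mul_of_nonneg_left hta' hq0.le
      nlinarith
  rw [decAt_iff_decAtT, gmean] at hdec
  exact decAtT_mono_top hdec hNM

/-- the gate of a finite mixture is the mixture of the gates (weights summing to `1`). [this work] -/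
theorem gate_mixture {ι : Type} [Fintype ι] (w : ι → ℝ) (ν : ι → ℕ → ℝ) (q : ℝ) (hw1 : ∑ i, w i = 1) (μ : ℕ → ℝ)
    (hμ : ∀ h, μ h = ∑ i, w i * ν i h) (h : ℕ) :
    gate μ q h = ∑ i, w i * gate (ν i) q h := by
  simp only [gate]
  rw [hμ h, Finset.mul_sum]
  have e : ∀ i, w i * (q * ν i h + (if h = 0 then 1 - q else 0)) = q * (w i * ν i h) + w i * (if h = 0 then 1 - q else 0) :=
    fun i => by ring
  simp_rw [e]
  rw [Finset.sum_add_distrib, ← Finset.sum_mul, hw1, one_mul]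

/-- **A FINITE MIXTURE OF GATED, TOP-AFFORDABLE, SDEC LAWS OF A COMMON MEAN IS SDEC**: `μ = Σᵢ wᵢ · gate Pᵢ sᵢ` on `{0..M}` with
`x < sᵢ ≤ 1`, `Pᵢ` a probability law on `{0..Nᵢ}`, `Nᵢ ≤ M`, top-affordable and SDEC at floor `x/sᵢ`, and `sᵢ · mean Pᵢ = mean μ` for
every `i` ⟹ `SDEC x M μ` (convexity of DEC at a fixed target, `decAtT_finite_mixture`). [this work] -/
theorem sdec_of_gatedSDECMixture {ι : Type} [Fintype ι] (x : ℝ) (M : ℕ) (μ : ℕ → ℝ)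
    (w s : ι → ℝ) (N : ι → ℕ) (P : ι → ℕ → ℝ) (hx0 : 0 < x)
    (hw0 : ∀ i, 0 ≤ w i) (hw1 : ∑ i, w i = 1) (hs : ∀ i, x < s i ∧ s i ≤ 1)
    (hP0 : ∀ i h, 0 ≤ P i h) (hPN : ∀ i h, N i < h → P i h = 0) (hP1 : ∀ i, ∑ h ∈ Finset.range (N i + 1), P i h = 1)
    (hta : ∀ i, x / s i * (N i : ℝ) ≤ ∑ h ∈ Finset.range (N i + 1), (h : ℝ) * P i h) (hsd : ∀ i, SDEC (x / s i) (N i) (P i))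
    (hNM : ∀ i, N i ≤ M)
    (hmean : ∀ i, s i * (∑ h ∈ Finset.range (N i + 1), (h : ℝ) * P i h) = ∑ h ∈ Finset.range (M + 1), (h : ℝ) * μ h)
    (hmix : ∀ h, μ h = ∑ i, w i * gate (P i) (s i) h) :
    SDEC x M μ := by
  classical
  intro q hq0 hq1 j' hj
  have hgate : ∀ h, gate μ q h = ∑ i, w i * gate (gate (P i) (s i)) q h :=
    gate_mixture w (fun i => gate (P i) (s i)) q hw1 μ hmix
  have hmeanq : ∑ h ∈ Finset.range (M + 1), (h : ℝ) * gate μ q h = q * ∑ h ∈ Finset.range (M + 1), (h : ℝ) * μ h :=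
    sum_mul_gate μ q M
  rw [decAt_iff_decAtT, hmeanq]
  refine decAtT_finite_mixture (q * x) _ j' M (gate μ q) w _ hw0 hw1 hgate fun i _ => ?_
  have := decAtT_gate_of_gatedSDEC x (s i) (N i) M (P i) hx0 (hs i).1 (hs i).2 (hP0 i) (hPN i) (hP1 i) (hta i) (hsd i) (hNM i)
    q hq0 hq1 j'
  rwa [hmean i] at this

/-! ### Consequences of the two conjectures -/

/-- **`GatedProductHull ∧ HeavyTopProductSDEC ⟹` every tree-built law is SDEC at its floor.** [this work] -/
theorem treeBuilt_sdec_of_gatedProductHull (hH : GatedProductHull) (hC : HeavyTopProductSDEC) {x : ℝ} {M : ℕ} {μ : ℕ → ℝ}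
    (h : TreeBuilt x M μ) : SDEC x M μ := by
  obtain ⟨hx0, -, -, -, -, -⟩ := treeBuilt_lawFacts h
  obtain ⟨ι, hι, w, s, N, P, hw0, hw1, hs, hP, hNM, hmean, hmix⟩ := hH x M μ h
  have hy : ∀ i, 0 < x / s i ∧ x / s i < 1 := fun i =>
    ⟨div_pos hx0 (hx0.trans (hs i).1), by rw [div_lt_one (hx0.trans (hs i).1)]; exact (hs i).1⟩
  exact sdec_of_gatedSDECMixture x M μ w s N P hx0 hw0 hw1 hs (fun i => (hP i).lawFacts.1) (fun i => (hP i).lawFacts.2.1)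
    (fun i => (hP i).lawFacts.2.2) (fun i => (hC _ _ _ (hy i).1 (hy i).2 (hP i)).1) (fun i => (hC _ _ _ (hy i).1 (hy i).2 (hP i)).2)
    hNM hmean hmix

/-- **`GatedProductHull ∧ HeavyTopProductSDEC ⟹` the far-relay row for every tree-built law at every floor**:
`2j < mean ⟹ x ≤ μ{j+1, …, M}`. [this work] -/
theorem treeBuilt_row_of_gatedProductHull (hH : GatedProductHull) (hC : HeavyTopProductSDEC) {x : ℝ} {M : ℕ} {μ : ℕ → ℝ}
    (h : TreeBuilt x M μ) (j : ℕ) (hdom : (2 * j : ℝ) < ∑ k ∈ Finset.range (M + 1), (k : ℝ) * μ k) :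
    x ≤ ∑ k ∈ Finset.Ico (j + 1) (M + 1), μ k := by
  obtain ⟨hx0, hx1, hμ0, hμM, hμ1, hta⟩ := treeBuilt_lawFacts h
  have hmeanle : ∑ k ∈ Finset.range (M + 1), (k : ℝ) * μ k ≤ (M : ℝ) := by
    calc ∑ k ∈ Finset.range (M + 1), (k : ℝ) * μ k ≤ ∑ k ∈ Finset.range (M + 1), (M : ℝ) * μ k :=
          Finset.sum_le_sum fun k hk => mul_le_mul_of_nonneg_right
            (by exact_mod_cast Nat.le_of_lt_succ (Finset.mem_range.1 hk)) (hμ0 k)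
      _ = (M : ℝ) := by rw [← Finset.mul_sum, hμ1, mul_one]
  have hjM : j < M := by
    by_contra hc
    have : (M : ℝ) ≤ j := by exact_mod_cast not_lt.1 hc
    linarith
  have hdec : DECAt x j M μ := by
    have := treeBuilt_sdec_of_gatedProductHull hH hC h 1 one_pos le_rfl j hjM
    rwa [gate_one, one_mul] at this
  exact tail_ge_of_decAt x j M μ hx1.le hdec hdom

end LawDec

/-- **`GatedProductHull ∧ HeavyTopProductSDEC ⟹ Quant.FarTreeRow`** — the R8 tree row at every floor from the two law-level conjectures of
the hull programme, by `LawDec.treeBuilt_row_of_gatedProductHull` and the bridge `farTreeRow_of_treeBuilt_rows`.  Conditional result: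
both hypotheses are `@[conjecture]`. [this work] -/
theorem farTreeRow_of_gatedProductHull (hH : LawDec.GatedProductHull) (hC : LawDec.HeavyTopProductSDEC) : FarTreeRow :=
  farTreeRow_of_treeBuilt_rows fun _ _ _ hT j hdom => LawDec.treeBuilt_row_of_gatedProductHull hH hC hT j hdom

end Quant

end Summit.CriticalPhenomena.PercolationContinuityZ3.Theorems

/-!
### CORRECTION (typer g35, appended): `GatedProductHull` is NUMERICALLY FALSE AT HEAVY FLOORS — the light-floor statement

After this file landed (p388237), an explicit-column, exact-mean linear programme (kit j230122, refined in j230186 with an 11× denser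
column set containing the tree's own parameters; both attached to the crux item) placed the DEPTH-3 TIED TREE
`gate_r(δ₁ ∗ gate_r(δ₁ ∗ R_r ∗ R_r) ∗ R_r)`, `r = y^{1/3}` (`M = 5`), OUTSIDE the convex hull of the gated iterated convolutions of
heavy-top laws of its mean at the heavy floors `y = .78 / .85 / .92` (L¹ distance `4.84e-3 / 2.12e-3 / 5.6e-4`, unchanged under the
refinement), while it is inside at `y = .45 / .6 / .7`.  So `LawDec.GatedProductHull` as stated above (every floor) should be regarded as
REFUTED NUMERICALLY (no kernel refutation is attempted here: it would need a certified dual functional over a semi-algebraic generator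
family), and `farTreeRow_of_gatedProductHull` above is, in all likelihood, a theorem with an unsatisfiable hypothesis.  The statement the
evidence supports is the LIGHT-FLOOR one below (`x < 1/2`; implied by `GatedPairHull`, and by `GatedProductHull`); with
`HeavyTopProductSDEC` it gives the far-relay row for tree-built laws at floors `< 1/2`, and `Quant.FarTreeRow` then follows from the
heavy-regime forest row by the split bridge `Quant.farTreeRow_of_heavy_and_lightRows` (`…QuantFarTreeRowSplit`):
`farTreeRow_of_heavy_and_lightRows hHeavy (fun _ _ _ hT hx j hd => LawDec.treeBuilt_row_light_of_gatedProductHullLight hH hC hT hx j hd)`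
(one line; not stated here only because that module's object file was not yet built when this correction was checked).
-/

namespace Summit.CriticalPhenomena.PercolationContinuityZ3.Theorems

namespace Quant

namespace LawDec

/-- **CONJECTURE (GATED PRODUCT HULL AT LIGHT FLOORS; typer g35 — the corrected form of `GatedProductHull`).**  Every tree-built count law
`μ` on `{0..M}` at a floor `x < 1/2` (`LawDec.TreeBuilt x M μ`) is a finite convex combination of gated iterated convolutions of heavy-top
laws of its own mean: laws `gate P s` with `x < s ≤ 1`, `HTProd (x/s) N P`, `N ≤ M`, `s · mean P = mean μ`.  Implied by `GatedPairHull`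
(two factors; ≈ 1 900 exact column-generation tests at floors ≤ .49, 0 genuine failures) and, trivially, by `GatedProductHull`; the
all-floors form is numerically false (correction note above).  builds on p205010 (kernel theorem, internal audit signed; external expert
review pending). [this work] [status: open] -/
@[conjecture] def GatedProductHullLight : Prop :=
  ∀ (x : ℝ) (M : ℕ) (μ : ℕ → ℝ), TreeBuilt x M μ → x < 1 / 2 →
    ∃ (ι : Type) (_ : Fintype ι) (w s : ι → ℝ) (N : ι → ℕ) (P : ι → ℕ → ℝ),
      (∀ i, 0 ≤ w i) ∧ (∑ i, w i = 1) ∧ (∀ i, x < s i ∧ s i ≤ 1) ∧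
      (∀ i, HTProd (x / s i) (N i) (P i)) ∧ (∀ i, N i ≤ M) ∧
      (∀ i, s i * (∑ h ∈ Finset.range (N i + 1), (h : ℝ) * P i h) = ∑ h ∈ Finset.range (M + 1), (h : ℝ) * μ h) ∧
      (∀ h, μ h = ∑ i, w i * gate (P i) (s i) h)

/-- the all-floors form implies the light-floor form. [this work] -/
theorem gatedProductHullLight_of_gatedProductHull (hH : GatedProductHull) : GatedProductHullLight :=
  fun x M μ h _ => hH x M μ h

/-- **`GatedProductHullLight ∧ HeavyTopProductSDEC ⟹` every tree-built law at a floor `x < 1/2` is SDEC.** [this work] -/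
theorem treeBuilt_sdec_light_of_gatedProductHullLight (hH : GatedProductHullLight) (hC : HeavyTopProductSDEC) {x : ℝ} {M : ℕ}
    {μ : ℕ → ℝ} (h : TreeBuilt x M μ) (hx : x < 1 / 2) : SDEC x M μ := by
  obtain ⟨hx0, -, -, -, -, -⟩ := treeBuilt_lawFacts h
  obtain ⟨ι, hι, w, s, N, P, hw0, hw1, hs, hP, hNM, hmean, hmix⟩ := hH x M μ h hx
  have hy : ∀ i, 0 < x / s i ∧ x / s i < 1 := fun i =>
    ⟨div_pos hx0 (hx0.trans (hs i).1), by rw [div_lt_one (hx0.trans (hs i).1)]; exact (hs i).1⟩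
  exact sdec_of_gatedSDECMixture x M μ w s N P hx0 hw0 hw1 hs (fun i => (hP i).lawFacts.1) (fun i => (hP i).lawFacts.2.1)
    (fun i => (hP i).lawFacts.2.2) (fun i => (hC _ _ _ (hy i).1 (hy i).2 (hP i)).1) (fun i => (hC _ _ _ (hy i).1 (hy i).2 (hP i)).2)
    hNM hmean hmix

/-- **`GatedProductHullLight ∧ HeavyTopProductSDEC ⟹` the far-relay row `2j < mean ⟹ x ≤ μ{j+1..M}` for every tree-built law at every
floor `x < 1/2`** — the light half of the tree row; assemble with the heavy-regime forest row by `farTreeRow_of_heavy_and_lightRows`.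
[this work] -/
theorem treeBuilt_row_light_of_gatedProductHullLight (hH : GatedProductHullLight) (hC : HeavyTopProductSDEC) {x : ℝ} {M : ℕ}
    {μ : ℕ → ℝ} (h : TreeBuilt x M μ) (hx : x < 1 / 2) (j : ℕ) (hdom : (2 * j : ℝ) < ∑ k ∈ Finset.range (M + 1), (k : ℝ) * μ k) :
    x ≤ ∑ k ∈ Finset.Ico (j + 1) (M + 1), μ k := by
  obtain ⟨hx0, hx1, hμ0, hμM, hμ1, hta⟩ := treeBuilt_lawFacts h
  have hmeanle : ∑ k ∈ Finset.range (M + 1), (k : ℝ) * μ k ≤ (M : ℝ) := by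
    calc ∑ k ∈ Finset.range (M + 1), (k : ℝ) * μ k ≤ ∑ k ∈ Finset.range (M + 1), (M : ℝ) * μ k :=
          Finset.sum_le_sum fun k hk => mul_le_mul_of_nonneg_right
            (by exact_mod_cast Nat.le_of_lt_succ (Finset.mem_range.1 hk)) (hμ0 k)
      _ = (M : ℝ) := by rw [← Finset.mul_sum, hμ1, mul_one]
  have hjM : j < M := by
    by_contra hc
    have : (M : ℝ) ≤ j := by exact_mod_cast not_lt.1 hc
    linarith
  have hdec : DECAt x j M μ := by
    have := treeBuilt_sdec_light_of_gatedProductHullLight hH hC h hx 1 one_pos le_rfl j hjM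
    rwa [gate_one, one_mul] at this
  exact tail_ge_of_decAt x j M μ hx1.le hdec hdom

end LawDec

end Quant

end Summit.CriticalPhenomena.PercolationContinuityZ3.Theorems
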